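import Mathlib
import HarnessLib
import Literature.NumberTheory.EllipticCurves.FramedTateGaloisRep
import Literature.NumberTheory.EllipticCurves.GaloisActionProofs
import Literature.NumberTheory.EllipticCurves.TateModuleFixedPointsProofs
import Literature.NumberTheory.EllipticCurves.EisensteinNewformLevelRaisingInertiaProofs
import Literature.NumberTheory.EllipticCurves.InertiaAboveEllCyclotomicProofs
import Literature.NumberTheory.EllipticCurves.ZpExtensionProofs
import Literature.NumberTheory.GaloisRepresentations.LocalKroneckerWeberInertiaProofs
import Literature.NumberTheory.Automorphic.AdicCompletionLocalField

/-!
# Stub `stub_cousinGaloisPackage` (line `descend-raise-basechange`, crux stmt-Langlands-12920, v4 cousin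
# graft) — auxiliary file I: a `ℤ_p`-basis of `T_p E` adapted to a basis of `E[p]`, and `ω|_{I_v} ≠ 1`

Helper lemmas (all proved, no new definition) for the Galois side S7a of the cousin graft of the line
`descend-raise-basechange` of `Summit.Langlands.Langlands.Theses.SkinnerWilesDefectOne.EisensteinProModularSeed`:

* `geomTorsion_generators`, `exists_adapted_pair`, `exists_basis_of_pairMap_bijective` — for an elliptic
  curve `E` over a field of characteristic `0` and `P, Q ∈ E[p]` with `P ≠ 0`, `Q ∉ ℤP`: `(P, Q)`
  generates `E[p]` (`#E[p] = p²`, Silverman III.6.4), lifts to a pair `(a, b)` of `T_p E` all of whose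
  level maps `(ℤ/p^k)² → E[p^k]` are bijective, and `(a, b)` is a `ℤ_p`-basis of `T_p E`
  (Silverman III.7.1; the tree's `TateModuleProofs`: `exists_proj_one_eq`, `levelMap_bijective`,
  `pairMap_bijective_of_levelMap_bijective`);
* `framedTateGaloisRepOfBasis_tensorBasis_apply` — the matrix entries of `V_p E` framed in the
  `ℚ_p`-basis `1 ⊗ (a, b)` are the images of the entries of the `ℤ_p`-matrices of `Γ_F` on `T_p E`
  (Mathlib `LinearMap.toMatrix_baseChange`), so they are `p`-adic integers
  (`v_algebraMap_padicInt_le_one`);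
* `toZModPow_toMatrix_eq` — **residual reading**: if `σ a ≡ x a + y b (mod p)` on `E[p]` then the
  first column of the matrix of `σ` in the basis `(a, b)` is `≡ (x, y) (mod p)` (injectivity of the
  level-`1` map), with the norm form `norm_sub_intCast_lt_one_of_toZModPow_eq`;
* `exists_mem_absInertia_toZModPow_cyclotomicCharacter_ne_one` — for `[F : ℚ] = 2` and `p ≥ 5`, at
  every `v ∣ p` some element of the local inertia group `I_{F_v}` has `χ_p ≢ 1 (mod p)`
  (`ω|_{I_v} ≠ 1`, as `e(F_v/ℚ_p) ≤ 2 < p - 1`): over `ℚ`, `χ_p(I) = ℤ_pˣ` (tree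
  `exists_mem_inertia_cyclotomicCharacter_eq`); the square of an inertia element with `χ_p = 2` is a
  restriction from `Γ_F` (`inv_mul_mem_range_absGaloisRestrict`, index `2`), lies in `I_𝔓`
  (`comap_inertia_comap_absIntegersMap`) and lifts to `I_{F_v}`
  (`exists_primesAbove_forall_inertia_absGaloisRestrict`); `4 ≢ 1 (mod p)`.

References: J. H. Silverman, *The Arithmetic of Elliptic Curves*, 2nd ed. (2009), Cor. III.6.4,
Prop. III.7.1; J. Neukirch, *Algebraic Number Theory*, Ch. II (7.13), (9.4)–(9.6). [folklore]
-/

set_option linter.dupNamespace false -- project-wide option (lakefile weak.linter.dupNamespace); `Summit.Langlands.Langlands` is the mandated namespace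

noncomputable section

namespace Summit.Langlands.Langlands.Theorems.SkinnerWilesDefectOne.EisensteinProModularSeed.Cousin

open Literature.NumberTheory.EllipticCurves Literature.NumberTheory.GaloisRepresentations
open Field IsDedekindDomain
open scoped NumberField MatrixGroups Matrix TensorProduct

universe u

/-! ### A `ℤ_p`-basis of `T_p E` adapted to a basis `(P, Q)` of `E[p]` -/

section AdaptedBasis

variable {F : Type u} [Field F] (W : WeierstrassCurve F) [W.IsElliptic] (p : ℕ) [Fact p.Prime]

/-- **Matrix entries of `V_p E` framed on a `ℤ_p`-basis of `T_p E`.**  For a `ℤ_p`-basis `bT` of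
`T_p E` and the induced `ℚ_p`-basis `1 ⊗ bT` of `V_p E = ℚ_p ⊗ T_p E` (Mathlib
`Algebra.TensorProduct.basis`), the `(i, j)` entry of `σ` on `V_p E` framed in `1 ⊗ bT`
(`WeierstrassCurve.framedTateGaloisRepOfBasis`) is the image in `ℚ̄_p` of the `(i, j)` entry of the
matrix of `σ` on `T_p E` in `bT` (Mathlib `LinearMap.toMatrix_baseChange`).  Silverman, *AEC*,
Remark III.7.2 ("a representation `G_{K̄/K} → GL₂(ℤ_ℓ)` … then `GL₂(ℚ_ℓ)`"). [folklore] -/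
theorem framedTateGaloisRepOfBasis_tensorBasis_apply (bT : Module.Basis (Fin 2) ℤ_[p] (W.tateModule p))
    (g : absoluteGaloisGroup F) (i j : Fin 2) :
    ((W.framedTateGaloisRepOfBasis p (W.continuous_rationalGaloisRepTate_holds p)
      (Algebra.TensorProduct.basis ℚ_[p] bT) g : GL (Fin 2) (PadicAlgCl p)) :
        Matrix (Fin 2) (Fin 2) (PadicAlgCl p)) i j =
      algebraMap ℚ_[p] (PadicAlgCl p)
        ((LinearMap.toMatrix bT bT (W.galoisRepTate p g) i j : ℤ_[p]) : ℚ_[p]) := by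
  rw [WeierstrassCurve.coe_framedTateGaloisRepOfBasis_apply, Matrix.map_apply]
  have key := LinearMap.toMatrix_baseChange ℚ_[p] (W.galoisRepTate p g) bT bT
  have key' := congrArg (fun N : Matrix (Fin 2) (Fin 2) ℚ_[p] => N i j) key
  simp only [Matrix.map_apply] at key'
  exact congrArg (algebraMap ℚ_[p] (PadicAlgCl p)) key'

/-- `p`-adic integers have valuation `≤ 1` in `ℚ̄_p`. [folklore] -/
theorem v_algebraMap_padicInt_le_one (z : ℤ_[p]) :
    Valued.v (algebraMap ℚ_[p] (PadicAlgCl p) (z : ℚ_[p])) ≤ 1 := by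
  rw [PadicAlgCl.valuation_def, ← NNReal.coe_le_coe, coe_nnnorm, NNReal.coe_one]
  change ‖((z : ℚ_[p]) : PadicAlgCl p)‖ ≤ 1
  rw [PadicAlgCl.norm_extends, ← PadicInt.norm_def]
  exact PadicInt.norm_le_one z

/-- For `z ∈ ℤ_p`: `v(z) < 1` in `ℚ̄_p` iff `‖z‖ < 1`. [folklore] -/
theorem v_algebraMap_padicInt_lt_one_iff (z : ℤ_[p]) :
    Valued.v (algebraMap ℚ_[p] (PadicAlgCl p) (z : ℚ_[p])) < 1 ↔ ‖z‖ < 1 := by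
  rw [PadicAlgCl.valuation_def, ← NNReal.coe_lt_coe, coe_nnnorm, NNReal.coe_one]
  change ‖((z : ℚ_[p]) : PadicAlgCl p)‖ < 1 ↔ _
  rw [PadicAlgCl.norm_extends, PadicInt.norm_def]

/-- `z ≡ x (mod p)` in `ℤ_p` (as `toZModPow 1 z = x`) gives `‖z - x‖ < 1`. [folklore] -/
theorem norm_sub_intCast_lt_one_of_toZModPow_eq {z : ℤ_[p]} {x : ℤ}
    (h : PadicInt.toZModPow 1 z = x) : ‖z - x‖ < 1 := by
  have hmem : z - x ∈ RingHom.ker (PadicInt.toZModPow (p := p) 1) := by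
    rw [RingHom.mem_ker, map_sub, h, map_intCast, sub_self]
  rw [PadicInt.ker_toZModPow, pow_one, Ideal.mem_span_singleton] at hmem
  exact PadicInt.norm_lt_one_iff_dvd _ |>.mpr hmem

variable [CharZero F]

/-- **`(P, Q)` generates `E[p]`** when `P ≠ 0` and `Q ∉ ℤP`: `E[p] = E(F̄)[p]` has `p²` elements
(`card_torsionPoints_eq_sq_holds`, Silverman Cor. III.6.4(b)), `ℤP` has `p`, and the subgroup
generated by `P, Q` strictly contains `ℤP`.  (The argument of the tree's
`TateModule.exists_generators_of_card_torsionBy`, for a GIVEN pair.) [cite: SilvermanAEC2009, Cor. III.6.4(b)] -/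
theorem geomTorsion_generators {P Q : W.geomTorsion p} (hP : P ≠ 0) (hQ : ∀ a : ℤ, Q ≠ a • P) :
    ∀ R ∈ W.geomTorsion p, ∃ m n : ℤ, m • (P : W.geomPoints) + n • (Q : W.geomPoints) = R := by
  have hp : p.Prime := Fact.out
  have hpF : (p : F) ≠ 0 := Nat.cast_ne_zero.mpr hp.ne_zero
  have hc1 : Nat.card (W.geomTorsion p) = p ^ 2 := by
    simpa using W.card_geomTorsion_pow_eq p (W.card_torsionPoints_eq_sq_holds (AlgebraicClosure F)) hpF 1
  haveI : Finite (W.geomTorsion p) :=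
    Nat.finite_of_card_ne_zero (by rw [hc1]; exact pow_ne_zero _ hp.ne_zero)
  intro R hR
  have hPmem := P.2
  have hQmem := Q.2
  have hP0' : (P : W.geomPoints) ≠ 0 := fun h ↦ hP (Subtype.ext h)
  have hordP : addOrderOf (P : W.geomPoints) = p :=
    addOrderOf_eq_prime (AddSubgroup.torsionBy.nsmul_iff.mp (by exact_mod_cast hPmem)) hP0'
  have hzP : AddSubgroup.zmultiples (P : W.geomPoints) ≤ W.geomTorsion p :=
    AddSubgroup.zmultiples_le.mpr hPmem
  have hcardzP : Nat.card (AddSubgroup.zmultiples (P : W.geomPoints)) = p := by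
    rw [Nat.card_zmultiples, hordP]
  have hQnot : (Q : W.geomPoints) ∉ AddSubgroup.zmultiples (P : W.geomPoints) := by
    rintro ⟨a, ha⟩
    exact hQ a (Subtype.ext (by simpa using ha.symm))
  set K := AddSubgroup.closure ({(P : W.geomPoints), (Q : W.geomPoints)} : Set W.geomPoints) with hKdef
  have hK : K ≤ W.geomTorsion p := by
    rw [hKdef, AddSubgroup.closure_le]
    rintro x hx
    rcases hx with rfl | rfl
    exacts [hPmem, hQmem]
  have hzK : AddSubgroup.zmultiples (P : W.geomPoints) ≤ K :=
    AddSubgroup.zmultiples_le.mpr (AddSubgroup.subset_closure (by simp))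
  have hQK : (Q : W.geomPoints) ∈ K := AddSubgroup.subset_closure (by simp)
  haveI : Finite K := Finite.of_injective _ (AddSubgroup.inclusion_injective hK)
  have hdvd : Nat.card K ∣ p ^ 2 := hc1 ▸ AddSubgroup.card_dvd_of_le hK
  obtain ⟨i, hi, hKi⟩ := (Nat.dvd_prime_pow hp).mp hdvd
  have hpK : p ∣ Nat.card K := hcardzP ▸ AddSubgroup.card_dvd_of_le hzK
  interval_cases i
  · rw [hKi, pow_zero, Nat.dvd_one] at hpK
    exact absurd hpK hp.one_lt.ne'
  · exfalso
    have hzKeq : AddSubgroup.zmultiples (P : W.geomPoints) = K :=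
      AddSubgroup.eq_of_le_of_card_ge hzK (by rw [hKi, hcardzP, pow_one])
    exact hQnot (hzKeq ▸ hQK)
  · have hKeq : K = W.geomTorsion p := AddSubgroup.eq_of_le_of_card_ge hK (by rw [hKi, hc1])
    have hRK : R ∈ K := hKeq ▸ hR
    exact AddSubgroup.mem_closure_pair.mp hRK

/-- **An adapted pair in `T_p E`.**  For `P ≠ 0`, `Q ∉ ℤP` in `E[p]` there are `a, b ∈ T_p E` with
first components `a₁ = P`, `b₁ = Q` such that `(x, y) ↦ x a + y b` is a bijection `ℤ_p² → T_p E` and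
every level map `(ℤ/p^k)² → E[p^k]`, `(x, y) ↦ x a_k + y b_k`, is bijective (Silverman, *AEC*,
Prop. III.7.1(a) from Cor. III.6.4(b): the tree's `exists_proj_one_eq`, `levelMap_bijective`,
`pairMap_bijective_of_levelMap_bijective`). [cite: SilvermanAEC2009, Prop. III.7.1(a)] -/
theorem exists_adapted_pair {P Q : W.geomTorsion p} (hP : P ≠ 0) (hQ : ∀ a : ℤ, Q ≠ a • P) :
    ∃ a b : W.tateModule p, TateModule.proj p 1 a = P ∧ TateModule.proj p 1 b = Q ∧
      Function.Bijective (TateModule.pairMap a b) ∧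
      ∀ k, Function.Bijective (TateModule.levelMap p a b k) := by
  have hp : p.Prime := Fact.out
  have hpF : (p : F) ≠ 0 := Nat.cast_ne_zero.mpr hp.ne_zero
  have hc : ∀ k : ℕ, Nat.card (W.geomTorsion (p ^ k : ℕ)) = p ^ (2 * k) :=
    W.card_geomTorsion_pow_eq p (W.card_torsionPoints_eq_sq_holds (AlgebraicClosure F)) hpF
  have hs := TateModule.exists_smul_eq_of_card_torsionBy (A := W.geomPoints) hc
  obtain ⟨a, ha⟩ := TateModule.exists_proj_one_eq (fun k P hP ↦ hs k hP) P.2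
  obtain ⟨b, hb⟩ := TateModule.exists_proj_one_eq (fun k P hP ↦ hs k hP) Q.2
  have hgen := geomTorsion_generators W p hP hQ
  have hlev : ∀ k, Function.Bijective (TateModule.levelMap p a b k) :=
    TateModule.levelMap_bijective a b hc (by rw [ha, hb]; exact hgen)
  exact ⟨a, b, ha, hb, TateModule.pairMap_bijective_of_levelMap_bijective a b hlev, hlev⟩

omit [W.IsElliptic] [CharZero F] in
/-- A pair `a, b ∈ T_p E` with `(x, y) ↦ x a + y b` bijective is a `ℤ_p`-basis of `T_p E`
(Mathlib `Module.Basis.mk`). Silverman, *AEC*, Prop. III.7.1(a). [folklore] -/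
theorem exists_basis_of_pairMap_bijective (a b : W.tateModule p)
    (h : Function.Bijective (TateModule.pairMap a b)) :
    ∃ bT : Module.Basis (Fin 2) ℤ_[p] (W.tateModule p), bT 0 = a ∧ bT 1 = b := by
  have hli : LinearIndependent ℤ_[p] ![a, b] := by
    rw [LinearIndependent.pair_iff]
    intro s t hst
    have h0 : TateModule.pairMap a b (s, t) = TateModule.pairMap a b 0 := by
      rw [TateModule.pairMap_apply, TateModule.pairMap_apply]; simpa using hst
    have := h.1 h0
    exact ⟨congrArg Prod.fst this, congrArg Prod.snd this⟩
  have hsp : ⊤ ≤ Submodule.span ℤ_[p] (Set.range ![a, b]) := by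
    intro x _
    obtain ⟨⟨s, t⟩, hst⟩ := h.2 x
    rw [TateModule.pairMap_apply] at hst
    rw [Matrix.range_cons, Matrix.range_cons, Matrix.range_empty, Set.union_empty,
      Set.singleton_union]
    exact Submodule.mem_span_pair.mpr ⟨s, t, hst⟩
  exact ⟨Module.Basis.mk hli hsp, by simp, by simp⟩

omit [W.IsElliptic] [CharZero F] in
/-- **Residual reading of a column.**  Let `bT = (a, b)` be a `ℤ_p`-basis of `T_p E` whose level-`1`
map `(x, y) ↦ x a₁ + y b₁` is injective on `(ℤ/p)²`, and `σ ∈ Γ_F` with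
`σ (bT j)₁ = x a₁ + y b₁` in `E[p]` (`x, y ∈ ℤ`).  Then the `j`-th column of the matrix of `σ` on
`T_p E` in the basis `bT` is `≡ (x, y) (mod p)`: `σ bT j = M₀ⱼ a + M₁ⱼ b` (Mathlib `Basis.sum_repr`,
`LinearMap.toMatrix_apply`) projects to `(M₀ⱼ mod p) a₁ + (M₁ⱼ mod p) b₁`. [folklore] -/
theorem toZModPow_toMatrix_eq {a b : W.tateModule p}
    (hinj : Function.Injective (TateModule.levelMap p a b 1))
    (bT : Module.Basis (Fin 2) ℤ_[p] (W.tateModule p)) (h0 : bT 0 = a) (h1 : bT 1 = b)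
    (g : absoluteGaloisGroup F) (j : Fin 2) {x y : ℤ}
    (hg : g • TateModule.proj p 1 (bT j) = x • TateModule.proj p 1 a + y • TateModule.proj p 1 b) :
    PadicInt.toZModPow 1 (LinearMap.toMatrix bT bT (W.galoisRepTate p g) 0 j) = x ∧
      PadicInt.toZModPow 1 (LinearMap.toMatrix bT bT (W.galoisRepTate p g) 1 j) = y := by
  set M := LinearMap.toMatrix bT bT (W.galoisRepTate p g) with hM
  have hsum : g • bT j = M 0 j • a + M 1 j • b := by
    have h := bT.sum_repr (W.galoisRepTate p g (bT j))
    rw [Fin.sum_univ_two, W.galoisRepTate_apply_apply, h0, h1] at h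
    rw [← h, hM, LinearMap.toMatrix_apply, LinearMap.toMatrix_apply]
    rfl
  have hproj := congrArg (TateModule.proj p 1) hsum
  rw [TateModule.proj_smul_of_distribMulAction, map_add, TateModule.proj_smul, TateModule.proj_smul,
    hg] at hproj
  have hlev : TateModule.levelMap p a b 1 ((x : ZMod (p ^ 1)), (y : ZMod (p ^ 1))) =
      TateModule.levelMap p a b 1 (PadicInt.toZModPow 1 (M 0 j), PadicInt.toZModPow 1 (M 1 j)) := by
    apply Subtype.ext
    rw [TateModule.coe_levelMap_intCast, TateModule.coe_levelMap]
    exact hproj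
  have := hinj hlev
  exact ⟨(congrArg Prod.fst this).symm, (congrArg Prod.snd this).symm⟩

end AdaptedBasis

/-! ### `ω|_{I_v} ≠ 1` at the places above `p ≥ 5` of a quadratic field -/

section Omega

/-- **`χ_p ≢ 1 (mod p)` on the local inertia group at `v ∣ p`, for `[F : ℚ] = 2` and `p ≥ 5`**
(i.e. `ω|_{I_{F_v}} ≠ 1`: `e(F_v/ℚ_p) ≤ 2 < p - 1`), together with the prime `𝔓₀ ∣ v` of `\bar ℤ_F`
of the chosen embedding `F̄ → \bar F_v`, whose inertia group receives `I_{F_v}`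
(`exists_primesAbove_forall_inertia_absGaloisRestrict`).  Proof: over `ℚ`, `χ_p(I_{𝔓₀ ∩ \bar ℤ}) = ℤ_pˣ`
(`exists_mem_inertia_cyclotomicCharacter_eq`, Neukirch II (7.13)); for `τ'` there with `χ_p(τ') = 2`,
`τ'²` is a restriction from `Γ_F` (`inv_mul_mem_range_absGaloisRestrict`, `[F : ℚ] = 2`) of an element
of `I_{𝔓₀}` (`comap_inertia_comap_absIntegersMap`, Neukirch I (9.4)), which lifts to `I_{F_v}`; its
cyclotomic character is `4 ≢ 1 (mod p)` (`cyclotomicCharacter_absGaloisRestrict`).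
[cite: NeukirchANT1999, Ch. II (7.13), Ch. I (9.4)] -/
theorem exists_mem_absInertia_toZModPow_cyclotomicCharacter_ne_one {F : Type} [Field F]
    [NumberField F] (hF2 : Module.finrank ℚ F = 2) (p : ℕ) [hp : Fact p.Prime] (hp5 : 5 ≤ p)
    (v : HeightOneSpectrum (𝓞 F)) (hpv : (p : 𝓞 F) ∈ v.asIdeal) :
    ∃ 𝔓 ∈ v.primesAbove,
      (∀ σ ∈ absInertia (v.adicCompletion F),
        absGaloisRestrict F (v.adicCompletion F) σ ∈ 𝔓.inertia (absoluteGaloisGroup F)) ∧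
      ∃ σ ∈ absInertia (v.adicCompletion F),
        PadicInt.toZModPow 1
          ((GaloisRep.cyclotomicCharacter (v.adicCompletion F) p σ : ℤ_[p]ˣ) : ℤ_[p]) ≠ 1 := by
  obtain ⟨𝔓, h𝔓, honto, hinto⟩ :=
    Hida2000Thm326.exists_primesAbove_forall_inertia_absGaloisRestrict F v
  refine ⟨𝔓, h𝔓, hinto, ?_⟩
  -- the place of `ℚ` below `v`
  obtain ⟨u, hu, hvu⟩ := exists_heightOneSpectrum_rat_under hp.out hpv
  have h𝔓' : 𝔓.comap (absIntegersMap ℚ F) ∈ u.primesAbove :=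
    comap_absIntegersMap_mem_primesAbove hu h𝔓
  -- the unit `2` of `ℤ_p`
  have h2unit : IsUnit ((2 : ℕ) : ℤ_[p]) := by
    rw [PadicInt.isUnit_iff]
    refine le_antisymm (PadicInt.norm_le_one _) (not_lt.mp fun hlt => ?_)
    have h' : ‖(((2 : ℕ) : ℤ) : ℤ_[p])‖ < 1 := by exact_mod_cast hlt
    rw [PadicInt.norm_int_lt_one_iff_dvd] at h'
    have : (p : ℤ) ≤ 2 := Int.le_of_dvd (by norm_num) h'
    omega
  set w : ℤ_[p]ˣ := h2unit.unit with hw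
  obtain ⟨τ', hτ'I, hτ'χ⟩ :=
    Literature.NumberTheory.EllipticCurves.exists_mem_inertia_cyclotomicCharacter_eq p hvu h𝔓' w
  -- `τ'²` is a restriction from `Γ_F`
  have hsq : τ' ^ 2 ∈ Set.range (absGaloisRestrict ℚ F) := by
    by_cases hτ' : τ' ∈ Set.range (absGaloisRestrict ℚ F)
    · obtain ⟨x, rfl⟩ := hτ'
      exact ⟨x ^ 2, map_pow _ _ _⟩
    · have hτ'' : τ'⁻¹ ∉ Set.range (absGaloisRestrict ℚ F) := by
        rintro ⟨x, hx⟩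
        exact hτ' ⟨x⁻¹, by rw [map_inv, hx, inv_inv]⟩
      have := Literature.NumberTheory.EllipticCurves.inv_mul_mem_range_absGaloisRestrict hF2 hτ'' hτ'
      rwa [inv_inv, ← pow_two] at this
  obtain ⟨τ, hτ⟩ := hsq
  have hτI : τ ∈ 𝔓.inertia (absoluteGaloisGroup F) := by
    rw [← comap_inertia_comap_absIntegersMap ℚ F 𝔓, Subgroup.mem_comap]
    change absGaloisRestrict ℚ F τ ∈ _
    rw [hτ]
    exact Subgroup.pow_mem _ hτ'I 2
  have hχτ : GaloisRep.cyclotomicCharacter F p τ = w ^ 2 := by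
    rw [cyclotomicCharacter_eq_cyclotomicCharacter_rat_absGaloisRestrict F p τ, hτ, map_pow, hτ'χ]
  obtain ⟨σ, hσI, hσ⟩ := honto τ hτI
  refine ⟨σ, hσI, ?_⟩
  haveI : NeZero (p : F) := ⟨Nat.cast_ne_zero.mpr hp.out.ne_zero⟩
  rw [← cyclotomicCharacter_absGaloisRestrict F (v.adicCompletion F) p σ, hσ, hχτ]
  -- `4 ≢ 1 (mod p)` for `p ≥ 5`
  rw [Units.val_pow_eq_pow_val, map_pow, hw, IsUnit.unit_spec, map_natCast]
  intro h4
  have h3 : ((3 : ℕ) : ZMod (p ^ 1)) = 0 := by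
    have : ((2 : ℕ) : ZMod (p ^ 1)) ^ 2 - 1 = 0 := by rw [h4, sub_self]
    have e : ((2 : ℕ) : ZMod (p ^ 1)) ^ 2 - 1 = ((3 : ℕ) : ZMod (p ^ 1)) := by push_cast; ring
    rw [← e, this]
  rw [ZMod.natCast_eq_zero_iff, pow_one] at h3
  have : p ≤ 3 := Nat.le_of_dvd (by norm_num) h3
  omega

end Omega

end Summit.Langlands.Langlands.Theorems.SkinnerWilesDefectOne.EisensteinProModularSeed.Cousin

namespace Summit.Langlands.Langlands.Theorems.SkinnerWilesDefectOne.EisensteinProModularSeed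

/-- **Registered sub-goal of `stub_cousinGaloisPackage` (auxiliary file I): an adapted pair in `T_p E`**
(= `Cousin.exists_adapted_pair`, stated with explicit binders, fully qualified): for an elliptic curve over
a field of characteristic `0` and `P ≠ 0`, `Q ∉ ℤP` in `E[p]`, the pair `(P, Q)` lifts to `a, b ∈ T_p E`
with `ℤ_p² → T_p E`, `(x, y) ↦ x a + y b`, bijective and all level maps bijective. Silverman, *AEC*,
Prop. III.7.1(a) with Cor. III.6.4(b). [cite: SilvermanAEC2009, Prop. III.7.1(a)] -/
theorem stub_cousinGaloisPackage_auxBasis :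
    ∀ (F : Type) [Field F] [CharZero F] (W : WeierstrassCurve F) [W.IsElliptic] (p : ℕ) [Fact p.Prime] (P Q : W.geomTorsion p), P ≠ 0 → (∀ a : ℤ, Q ≠ a • P) → ∃ a b : W.tateModule p, Literature.NumberTheory.EllipticCurves.TateModule.proj p 1 a = P ∧ Literature.NumberTheory.EllipticCurves.TateModule.proj p 1 b = Q ∧ Function.Bijective (Literature.NumberTheory.EllipticCurves.TateModule.pairMap a b) ∧ ∀ k, Function.Bijective (Literature.NumberTheory.EllipticCurves.TateModule.levelMap p a b k) :=
  fun _ _ _ W _ p _ _ _ hP hQ => Cousin.exists_adapted_pair W p hP hQ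

end Summit.Langlands.Langlands.Theorems.SkinnerWilesDefectOne.EisensteinProModularSeed

end
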